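import Mathlib
import Literature.AlgebraicGeometry.Motives.ChernClassesProofs
import Summits.ResolutionOfSingularities.ResolutionOfSingularities.Theorems.HomologicalConductorNoZenoFullSheafEndLift
import Summits.ResolutionOfSingularities.ResolutionOfSingularities.Theorems.HomologicalConductorNoZenoFullSheafCoh
import HarnessLib

/-!
# Crux `NoZenoR` (stmt-ResolutionOfSingularities-19943), line `sandwich-cluster`, G-layer:
# G2 (v) — `End_T(M) ≃ End(M~)` for the full sheaf, GIVEN (ii) `Γ(X, M~) = φ(M)` (A4, inverse half + equivalence)

OURS (cell res-hironaka, chain W4.4; KERNEL-L0 §16 R6 row G2, holder res-D-pv-045 AS res-L0-w44-stub-8;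
plan `D/res-D-pv-045/SketchG2Assembly.lean` A4). Sequel of `…FullSheafEndLift` (`sheafEnd u : M~ ⟶ M~`).
Nothing of [claim: Hironaka2017] is used.

Hypothesis (ii) enters as `hH0 : ∀ v, (∀ x, v ∈ 𝒪_{X,x} · φ(M)) ↔ v ∈ φ(M)` (res-D-pv-053's
`fullSheaf_range_fn_eq`), i.e. the global sections of `M~ = 𝒪_X · φ(M)` have exactly the values `φ(M)`.

* `globalValue V S : Γ(M~, ⊤) →+ V` (value at the generic point), injective; under `hH0` its range is `φ(M)`;
* **`endOfSheafEnd … f : Module.End T M`** — the endomorphism of `M ≅ φ(M) = Γ(X, M~)` induced by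
  `f : M~ ⟶ M~` on global sections (`T`-linear: `T` acts on global sections through a ring map
  `ρ : T → Γ(X, 𝒪_X)` over `K(X)`, hypothesis `hρ`; in the application `ρ = algebraMapΓ π`);
* `endOfSheafEnd_sheafEnd` (`u ↦ sheafEnd u ↦ u`) and `sheafEnd_endOfSheafEnd` (`f ↦ ψ_f ↦ f`, by
  `hom_ext_of_app_ofMem`: both sides take `σ_{φ m}` to the section with value `φ (ψ_f m)`);
* **`sheafEndEquiv : Module.End T M ≃+ (M~ ⟶ M~)`** — G2 (v) as an additive equivalence, multiplicative
  up to the order of composition (`sheafEnd_mul`, EndLift file).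

Everything is proved; no named facts. [this work]
-/

-- single-problem summit: the doubled namespace component `ResolutionOfSingularities` is forced
set_option linter.dupNamespace false

noncomputable section

universe u

open CategoryTheory AlgebraicGeometry TopologicalSpace Opposite
open Literature.AlgebraicGeometry.Motives

namespace Summit.ResolutionOfSingularities.ResolutionOfSingularities.Theorems.NoZeno.SandwichCluster.FullSheaf

variable {X : Scheme.{u}} [IsIntegral X]
variable (V : Type u) [AddCommGroup V] [Module X.functionField V] (S : Set V)

attribute [local instance] stalkModule stalk_isScalarTower fnModule nonempty_top

/-! ## The value of a global section -/

/-- The generic point as a point of the open `⊤`. [folklore] -/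
def topPt : ((⊤ : X.Opens) : Type u) := ⟨genericPoint X, trivial⟩

/-- **The value of a global section of `𝒪_X · S`** (at the generic point; sections are constant). [folklore] -/
def globalValue : Γ(generatedSheaf (X := X) V S, ⊤) →+ V where
  toFun s := fn V S s topPt
  map_zero' := rfl
  map_add' _ _ := rfl

/-- Unfolding of `globalValue`. [folklore] -/
theorem globalValue_apply (s : Γ(generatedSheaf (X := X) V S, ⊤)) : globalValue V S s = fn V S s topPt := rfl

/-- `globalValue` is injective. [folklore] -/
theorem globalValue_injective : Function.Injective (globalValue V S (X := X)) :=
  fn_apply_injective V S topPt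

/-- The value of `σ_v`. [folklore] -/
@[simp]
theorem globalValue_ofMem (v : V) (hv : v ∈ S) : globalValue V S (ofMem (X := X) V S ⊤ v hv) = v := rfl

/-- Restricting a global section does not change its values. [folklore] -/
theorem fn_map_top (s : Γ(generatedSheaf (X := X) V S, ⊤)) (U : X.Opens) (y : U) :
    fn V S ((generatedSheaf V S).presheaf.map (homOfLE (le_top : U ≤ ⊤)).op s) y = globalValue V S s := by
  rw [fn_map, globalValue_apply]
  exact fn_apply_eq_fn_apply V S s _ _

/-- Under (ii), every global section of `M~` has its value in `φ(M)`. [folklore] -/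
theorem globalValue_mem (hH0 : ∀ v : V, (∀ x : X, v ∈ stalkSpan V S x) ↔ v ∈ S)
    (s : Γ(generatedSheaf (X := X) V S, ⊤)) : globalValue V S s ∈ S :=
  (hH0 _).mp fun x => by
    rw [globalValue_apply, fn_apply_eq_fn_apply V S s topPt ⟨x, trivial⟩]
    exact fn_mem_stalkSpan V S s ⟨x, trivial⟩

/-! ## (v): `End(M~) → End_T(M)` and the equivalence -/

section Values

variable {V}
variable {T : Type*} [CommRing T] [Module T V]
variable {M : Type*} [AddCommGroup M] [Module T M]

/-- `m ↦ σ_{φ m}`, the global section of `M~` attached to `m ∈ M` (additive). [folklore] -/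
def secOf (φ : M →ₗ[T] V) : M →+ Γ(generatedSheaf (X := X) V (Set.range φ), ⊤) where
  toFun m := ofMem V (Set.range φ) ⊤ (φ m) ⟨m, rfl⟩
  map_zero' := section_ext V (Set.range φ) (funext fun _ => by rw [fn_ofMem, map_zero]; rfl)
  map_add' m m' := section_ext V (Set.range φ) (funext fun _ => by rw [fn_ofMem, map_add]; rfl)

/-- Value of `σ_{φ m}`. [folklore] -/
@[simp]
theorem globalValue_secOf (φ : M →ₗ[T] V) (m : M) : globalValue V (Set.range φ) (secOf (X := X) φ m) = φ m := rfl

/-- `σ_{φ (a • m)} = ρ(a) • σ_{φ m}` when `ρ : T → Γ(X, 𝒪_X)` lifts `T → K(X)`. [folklore] -/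
theorem secOf_smul [Algebra T X.functionField] [IsScalarTower T X.functionField V] (φ : M →ₗ[T] V)
    (ρ : T →+* Γ(X, ⊤))
    (hρ : ∀ a : T, X.germToFunctionField ⊤ (ρ a) = algebraMap T X.functionField a) (a : T) (m : M) :
    secOf (X := X) φ (a • m) = ρ a • secOf φ m :=
  section_ext V (Set.range φ) (funext fun y => by
    change φ (a • m) = fn V (Set.range φ) (ρ a • secOf φ m) y
    rw [fn_smul, LinearMap.map_smul, evalFn_eq_germToFunctionField, hρ, algebraMap_smul]; rfl)

/-- The action of `f : M~ ⟶ M~` on the values of global sections: `m ↦ value of f(σ_{φ m})`. [folklore] -/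
def endValue (φ : M →ₗ[T] V)
    (f : generatedSheaf (X := X) V (Set.range φ) ⟶ generatedSheaf V (Set.range φ)) : M →+ V :=
  (globalValue V (Set.range φ)).comp ((f.app ⊤).hom.comp (secOf φ))

/-- Unfolding of `endValue`. [folklore] -/
theorem endValue_apply (φ : M →ₗ[T] V)
    (f : generatedSheaf (X := X) V (Set.range φ) ⟶ generatedSheaf V (Set.range φ)) (m : M) :
    endValue φ f m = globalValue V (Set.range φ) (f.app ⊤ (secOf φ m)) := rfl

/-- `endValue` is `T`-semilinear: `w_f (a • m) = a • w_f m`. [folklore] -/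
theorem endValue_smul [Algebra T X.functionField] [IsScalarTower T X.functionField V] (φ : M →ₗ[T] V)
    (ρ : T →+* Γ(X, ⊤))
    (hρ : ∀ a : T, X.germToFunctionField ⊤ (ρ a) = algebraMap T X.functionField a)
    (f : generatedSheaf (X := X) V (Set.range φ) ⟶ generatedSheaf V (Set.range φ)) (a : T) (m : M) :
    endValue φ f (a • m) = algebraMap T X.functionField a • endValue φ f m := by
  rw [endValue_apply, endValue_apply, secOf_smul φ ρ hρ]
  change globalValue V (Set.range φ) (f.app ⊤ (ρ a • secOf φ m)) = _
  rw [Scheme.Modules.Hom.app_smul, globalValue_apply, globalValue_apply, fn_smul,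
    evalFn_eq_germToFunctionField, hρ]

/-- Under (ii), `endValue` lands in `φ(M)`. [folklore] -/
theorem endValue_mem (φ : M →ₗ[T] V)
    (hH0 : ∀ v : V, (∀ x : X, v ∈ stalkSpan (X := X) V (Set.range φ) x) ↔ v ∈ Set.range φ)
    (f : generatedSheaf (X := X) V (Set.range φ) ⟶ generatedSheaf V (Set.range φ)) (m : M) :
    endValue φ f m ∈ LinearMap.range φ := by
  rw [LinearMap.mem_range]
  obtain ⟨m', hm'⟩ := globalValue_mem V (Set.range φ) hH0 (f.app ⊤ (secOf φ m))
  exact ⟨m', hm'⟩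

end Values

section End

variable {V}
variable {T : Type*} [CommRing T] [IsDomain T] [Algebra T X.functionField] [IsFractionRing T X.functionField]
variable [Module T V] [IsScalarTower T X.functionField V]
variable {M : Type*} [AddCommGroup M] [Module T M]

omit [IsDomain T] [IsFractionRing T X.functionField] in
/-- **`endOfSheafEnd f : End_T(M)`**, the action of `f : M~ ⟶ M~` on `M ≅ φ(M) = Γ(X, M~)` (GIVEN (ii)),
`φ (ψ_f m) = value of f(σ_{φ m})`. [this work] -/
def endOfSheafEnd (φ : M →ₗ[T] V) (hφinj : Function.Injective φ) (ρ : T →+* Γ(X, ⊤))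
    (hρ : ∀ a : T, X.germToFunctionField ⊤ (ρ a) = algebraMap T X.functionField a)
    (hH0 : ∀ v : V, (∀ x : X, v ∈ stalkSpan (X := X) V (Set.range φ) x) ↔ v ∈ Set.range φ)
    (f : generatedSheaf (X := X) V (Set.range φ) ⟶ generatedSheaf V (Set.range φ)) : Module.End T M where
  toFun m := (LinearEquiv.ofInjective φ hφinj).symm ⟨endValue φ f m, endValue_mem φ hH0 f m⟩
  map_add' m m' := by
    rw [← map_add]
    congr 1
    exact Subtype.ext (map_add (endValue φ f) m m')
  map_smul' a m := by
    rw [RingHom.id_apply, ← map_smul (LinearEquiv.ofInjective φ hφinj).symm a]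
    congr 1
    apply Subtype.ext
    change endValue φ f (a • m) = a • endValue φ f m
    rw [endValue_smul φ ρ hρ, algebraMap_smul]

omit [IsDomain T] [IsFractionRing T X.functionField] in
/-- Defining property: `φ (ψ_f m) = w_f m = value of f(σ_{φ m})`. [folklore] -/
theorem map_endOfSheafEnd (φ : M →ₗ[T] V) (hφinj : Function.Injective φ) (ρ : T →+* Γ(X, ⊤))
    (hρ : ∀ a : T, X.germToFunctionField ⊤ (ρ a) = algebraMap T X.functionField a)
    (hH0 : ∀ v : V, (∀ x : X, v ∈ stalkSpan (X := X) V (Set.range φ) x) ↔ v ∈ Set.range φ)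
    (f : generatedSheaf (X := X) V (Set.range φ) ⟶ generatedSheaf V (Set.range φ)) (m : M) :
    φ (endOfSheafEnd φ hφinj ρ hρ hH0 f m) = globalValue V (Set.range φ) (f.app ⊤ (secOf φ m)) := by
  change φ ((LinearEquiv.ofInjective φ hφinj).symm ⟨endValue φ f m, endValue_mem φ hH0 f m⟩) = _
  have h := LinearEquiv.apply_symm_apply (LinearEquiv.ofInjective φ hφinj)
    ⟨endValue φ f m, endValue_mem φ hH0 f m⟩
  have h' := congrArg Subtype.val h
  rw [LinearEquiv.ofInjective_apply] at h'
  exact h'.trans (endValue_apply φ f m)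

/-- `u ↦ sheafEnd u ↦ u`. [this work] -/
theorem endOfSheafEnd_sheafEnd (φ : M →ₗ[T] V) (hφinj : Function.Injective φ)
    (hspan : Submodule.span X.functionField (Set.range φ) = ⊤) (ρ : T →+* Γ(X, ⊤))
    (hρ : ∀ a : T, X.germToFunctionField ⊤ (ρ a) = algebraMap T X.functionField a)
    (hH0 : ∀ v : V, (∀ x : X, v ∈ stalkSpan (X := X) V (Set.range φ) x) ↔ v ∈ Set.range φ)
    (u : Module.End T M) : endOfSheafEnd φ hφinj ρ hρ hH0 (sheafEnd φ hφinj hspan u) = u := by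
  refine LinearMap.ext fun m => hφinj ?_
  rw [map_endOfSheafEnd]
  change globalValue V (Set.range φ) ((sheafEnd φ hφinj hspan u).app ⊤
    (ofMem V (Set.range φ) ⊤ (φ m) ⟨m, rfl⟩)) = φ (u m)
  rw [sheafEnd_app_ofMem, globalValue_ofMem]

/-- `f ↦ ψ_f ↦ sheafEnd ψ_f = f` (two morphisms out of `M~` agreeing on the `σ_{φ m}`). [this work] -/
theorem sheafEnd_endOfSheafEnd (φ : M →ₗ[T] V) (hφinj : Function.Injective φ)
    (hspan : Submodule.span X.functionField (Set.range φ) = ⊤) (ρ : T →+* Γ(X, ⊤))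
    (hρ : ∀ a : T, X.germToFunctionField ⊤ (ρ a) = algebraMap T X.functionField a)
    (hH0 : ∀ v : V, (∀ x : X, v ∈ stalkSpan (X := X) V (Set.range φ) x) ↔ v ∈ Set.range φ)
    (f : generatedSheaf (X := X) V (Set.range φ) ⟶ generatedSheaf V (Set.range φ)) :
    sheafEnd φ hφinj hspan (endOfSheafEnd φ hφinj ρ hρ hH0 f) = f := by
  refine hom_ext_of_app_ofMem V (Set.range φ) _ _ fun U _ _ v hv => ?_
  obtain ⟨m, rfl⟩ := hv
  rw [sheafEnd_app_ofMem]
  -- `σ_{φ m}` over `U` is the restriction of the global `σ_{φ m}`; compare values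
  have hres : ofMem V (Set.range φ) U (φ m) ⟨m, rfl⟩ =
      (generatedSheaf V (Set.range φ)).presheaf.map (homOfLE (le_top : U ≤ ⊤)).op (secOf φ m) :=
    section_ext V (Set.range φ) (funext fun _ => rfl)
  rw [hres, Scheme.Modules.Hom.app_map_apply]
  refine section_ext V (Set.range φ) (funext fun y => ?_)
  rw [fn_ofMem, fn_map_top, map_endOfSheafEnd]

/-- **G2 (v): `End_T(M) ≃ End(M~)`** (additive; multiplicative by `sheafEnd_mul`), GIVEN (ii). [this work] -/
def sheafEndEquiv (φ : M →ₗ[T] V) (hφinj : Function.Injective φ)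
    (hspan : Submodule.span X.functionField (Set.range φ) = ⊤) (ρ : T →+* Γ(X, ⊤))
    (hρ : ∀ a : T, X.germToFunctionField ⊤ (ρ a) = algebraMap T X.functionField a)
    (hH0 : ∀ v : V, (∀ x : X, v ∈ stalkSpan (X := X) V (Set.range φ) x) ↔ v ∈ Set.range φ) :
    Module.End T M ≃+ (generatedSheaf (X := X) V (Set.range φ) ⟶ generatedSheaf V (Set.range φ)) where
  toFun := sheafEnd φ hφinj hspan
  invFun := endOfSheafEnd φ hφinj ρ hρ hH0
  left_inv := endOfSheafEnd_sheafEnd φ hφinj hspan ρ hρ hH0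
  right_inv := sheafEnd_endOfSheafEnd φ hφinj hspan ρ hρ hH0
  map_add' := sheafEnd_add φ hφinj hspan

/-- Unfolding of `sheafEndEquiv`. [folklore] -/
@[simp]
theorem sheafEndEquiv_apply (φ : M →ₗ[T] V) (hφinj : Function.Injective φ)
    (hspan : Submodule.span X.functionField (Set.range φ) = ⊤) (ρ : T →+* Γ(X, ⊤))
    (hρ : ∀ a : T, X.germToFunctionField ⊤ (ρ a) = algebraMap T X.functionField a)
    (hH0 : ∀ v : V, (∀ x : X, v ∈ stalkSpan (X := X) V (Set.range φ) x) ↔ v ∈ Set.range φ)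
    (u : Module.End T M) : sheafEndEquiv φ hφinj hspan ρ hρ hH0 u = sheafEnd φ hφinj hspan u := rfl

end End

end Summit.ResolutionOfSingularities.ResolutionOfSingularities.Theorems.NoZeno.SandwichCluster.FullSheaf

end
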